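import Summits.QuantumFields.YangMills.Theorems.UnitScaleTiltHalvingCombPairGauge
import Literature.MathematicalPhysics.QuantumFieldTheory.Balaban1983to89.Node00.TorusCoverBlockAveragingZd
import Literature.MathematicalPhysics.QuantumFieldTheory.Balaban1983to89.B5QGGQ145Torus
import HarnessLib

/-!
# Line H (`BirthV10.stub_halvingStep`, stmt-QuantumFields-19200) — LEMMA B-al-2, brick (B-iv), GEOMETRY HALF: the torus section over the corner box, the lift of the
# two-block bonds, and the conjugation identity `(ṽ•D)⁻¹(v•C) ∼ D⁻¹C` ([Balaban1987RG1] (0.1)–(0.3), [Balaban1985Averaging] (8)∕(11))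

Cell `ym3-torus` (HUMAN RULING D-0037: YM₃ on T³ is ladder rung R3 — NOT d = 4, NOT infinite volume, NOT a mass gap, NOT the Clay problem), width seat `ym-ust-19200-w3` gen 10
(LEAD-H ★w5-19200 g7 WORD 10 (2): LEMMA B-al ≡ (N1); SIGNATURE B-al-2 v1 cea012fa, brick (B-iv) geometry).  `--supports stmt-QuantumFields-19200 --as helper`; THEOREMS ONLY (0 `def`,
0 `sorry`); count-neutral; nothing here claims B-al-2's tower, `H42topCrossT`, (M2′), the stub, the crux or the gap.

WHAT.  The bookkeeping half of the level step `H_j ⇒ H_{j+1}` of B-al-2 (the analytic chain — ✓B-al-1, ✓(B-i)(B-ii) pair gauge, ✓(B-iii) torus Lipschitz, block-constant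
covariance — is assembled in the companion STEP file).  `π_j = coverAt j : ℤᵈ → T^{(j)}`; `q = Lz`; the corner box `Q = [q, bondHi L q κ]` of the `L`-bond `⟨q, q + Le_κ⟩`.
* §1 `coverAt_sec`∕`sec_coverAt`∕`sec_window` — the SECTION `sec_q x̂ = q + val(x̂ − π_j q)` of `π_j` (coordinatewise least residue): `π_j ∘ sec_q = id`, `sec_q ∘ π_j = id` on the window
  `[q, q + N_j)`; `blockMap_window`, `inBox_of_blockOf_coverAt` (with lit ✓`B5QGGQ145Torus.int_eq_zero_of_dvd_of_lt`) — a window point whose block is `π_{j+1} z` or `π_{j+1}(z + e_κ)` lies in `Q`;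
  ★ `lift_twoBlock_bond` — every torus bond with both ends in the two blocks of `ĉ = ⟨π_{j+1} z, κ⟩` is `(π_j x, μ)` with `x, x + e_μ ∈ Q` (two levels of room `j + 2 ≤ m + K`, so that
  `N_{j+1} ≥ 2L`).  This is what lets the two-block hypotheses of ✓`norm_dbarAvgU_inv_mul_sub_one_le` ∕ ✓B-al-1 be discharged from `ℤᵈ` data on `Q`.
* §2 ★ `norm_inv_gaugeActT_mul_gaugeAct_sub_one_le` — for the block-constant gauges `v = f ∘ blockOf ∘ π_j` (ℤᵈ) and `ṽ = f ∘ blockOf` (torus) and a lifted bond: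
  `‖(ṽ•D)(b̂)⁻¹·(v•C)(x,μ) − 1‖ ≤ ‖D(b̂)⁻¹·C(x,μ) − 1‖` (a unitary conjugation by `v(x + e_μ)`): the induction hypothesis `H_j` passes to the gauged pair unchanged;
  `norm_sub_le_of_inv_mul` — multiplicative-to-additive bookkeeping (`‖S − W‖ ≤ (102∕100)ρ`, `‖W − 1‖ ≤ δ + (102∕100)ρ`).
HONEST SCOPE.  Geometry and algebra only; the STEP estimate and the k-level recursion are NOT here.

References: T. Bałaban, CMP **98** (1985) 17–51 [Balaban1985Averaging] ((11) p.19, (42) p.23, p.24, (89) p.31, Prop. 4 (134)–(135) pp.38–39); CMP **109** (1987) 249–301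
[Balaban1987RG1] ((0.1)–(0.4) pp.251–253); CMP **102** (1985) 255–275 [Balaban1985UV3] ((27)–(28) p.263).
-/

set_option autoImplicit false

noncomputable section

open scoped BigOperators Matrix.Norms.L2Operator
open NormedSpace

namespace Summit.QuantumFields.YangMills.Theorems.HalvingCombStepGeometry

open Literature.MathematicalPhysics.QuantumFieldTheory.Balaban1983to89
open Literature.MathematicalPhysics.QuantumLattice (blockMap)
open B14DomainGeom (Pt)
open Node00 (coverAt coverAt_apply val_coverAt coverAt_eq_coverAt_iff blockOf_coverAt coverAt_add_e)
open B7Prop1Explicit (e e_apply hol treeWord boxVec axialFn gaugeAct l1 U1 mem_U1 axialFn_mem gaugeAct_mem norm_units_conj_sub_one_le norm_units_inv_conj_sub_one_le bavg)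
open B7Prop1Local (InBox bondHi AgreeOn)
open B8Lemma1NonAbelian (PlaqSmall)
open B10Eq27TorusAxialLog (gaugeActT gaugeActT_apply)
open HalvingCombPairGauge (dbavg_gaugeAct_eq_of_blockConst norm_gaugeAct_pairGauge_sub_one_le exists_boxVec_of_inBox_bondHi inBox_bondHi_of_boxVec)

variable {P : Params} {j : ℕ}

/-! ## §1 The torus section over the corner box and the lift of the two-block bonds -/

section Geometry

/-- **THE SECTION OF `π_j` BASED AT `q`**: `sec_q x̂ = q + val(x̂ − π_j q)` (coordinatewise least non-negative residue) has `π_j (sec_q x̂) = x̂`. [cite: Balaban1987RG1, (0.1) p.251] -/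
theorem coverAt_sec (q : Pt P.d) (y : Site P j) :
    coverAt P j (q + fun μ => ((y μ - coverAt P j q μ).val : ℤ)) = y := by
  funext μ
  simp only [coverAt_apply, Pi.add_apply, Int.cast_add, ZMod.natCast_val, ZMod.intCast_cast, ZMod.cast_id', id_eq]
  rw [add_sub_cancel]

/-- The section reproduces every `x` of the window `q ≤ x < q + N_j`: `sec_q (π_j x) = x`. [cite: Balaban1987RG1, (0.1) p.251] -/
theorem sec_coverAt (q x : Pt P.d) (hx : ∀ μ, 0 ≤ x μ - q μ ∧ x μ - q μ < (P.sitesPerDir j : ℕ)) :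
    (q + fun μ => ((coverAt P j x μ - coverAt P j q μ).val : ℤ)) = x := by
  funext μ
  have e : coverAt P j x μ - coverAt P j q μ = coverAt P j (x - q) μ := by simp only [coverAt_apply, Pi.sub_apply, Int.cast_sub]
  rw [Pi.add_apply, e, val_coverAt, Pi.sub_apply, Int.emod_eq_of_lt (hx μ).1 (hx μ).2]
  ring

/-- The section lands in the window `[q, q + N_j)`. [cite: Balaban1987RG1, (0.1) p.251] -/
theorem sec_window (q : Pt P.d) (y : Site P j) (μ : Fin P.d) :
    0 ≤ (q + fun μ => ((y μ - coverAt P j q μ).val : ℤ)) μ - q μ ∧ (q + fun μ => ((y μ - coverAt P j q μ).val : ℤ)) μ - q μ < (P.sitesPerDir j : ℕ) := by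
  simp only [Pi.add_apply, add_sub_cancel_left]
  exact ⟨Int.natCast_nonneg _, by exact_mod_cast ZMod.val_lt _⟩

/-- Floor division of a window point: `Lz ≤ x < Lz + N′L` gives `z ≤ ⌊x∕L⌋ < z + N′` coordinatewise. [folklore] -/
theorem blockMap_window {L N' : ℕ} (hL : 0 < L) (z x : Pt P.d) (μ : Fin P.d)
    (hx : 0 ≤ x μ - ((L : ℤ) • z) μ ∧ x μ - ((L : ℤ) • z) μ < ((N' * L : ℕ) : ℤ)) :
    0 ≤ blockMap L x μ - z μ ∧ blockMap L x μ - z μ < N' := by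
  have hL' : (0 : ℤ) < L := by exact_mod_cast hL
  simp only [blockMap, Pi.smul_apply, smul_eq_mul] at hx ⊢
  constructor
  · have : z μ ≤ x μ / L := Int.le_ediv_of_mul_le hL' (by linarith)
    linarith
  · have : x μ / L < z μ + N' := Int.ediv_lt_of_lt_mul hL' (by push_cast at hx; linarith)
    linarith

/-- **LIFT OF A TWO-BLOCK SITE.**  If `blockOf (π_j x) ∈ {π_{j+1} z, π_{j+1}(z + e_κ)}` and `x` lies in the window `Lz ≤ x < Lz + N_j` (so `x = sec_{Lz}(π_j x)`), then `x` lies in the corner box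
`Q = [Lz, bondHi L (Lz) κ]` (two levels of room: `j + 2 ≤ m + K`). [cite: Balaban1987RG1, (0.1)-(0.3) pp.251-252] -/
theorem inBox_of_blockOf_coverAt (hj2 : j + 2 ≤ P.m + P.K) (z x : Pt P.d) (κ : Fin P.d)
    (hx : ∀ μ, 0 ≤ x μ - ((P.L : ℤ) • z) μ ∧ x μ - ((P.L : ℤ) • z) μ < (P.sitesPerDir j : ℕ))
    (hb : blockOf (coverAt P j x) = coverAt P (j + 1) z ∨ blockOf (coverAt P j x) = coverAt P (j + 1) (z + e κ)) :
    InBox ((P.L : ℤ) • z) (bondHi P.L ((P.L : ℤ) • z) κ) x := by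
  have hj : j + 1 ≤ P.m + P.K := by omega
  have hL : 0 < P.L := by have := P.hL.2; omega
  have hNL := P.sitesPerDir_eq_mul_succ hj
  have hN'2 : 2 ≤ P.sitesPerDir (j + 1) := by
    unfold Params.sitesPerDir
    have : 1 ≤ P.L ^ (P.m + P.K - (j + 1)) := Nat.one_le_pow _ _ hL
    omega
  rw [blockOf_coverAt hj, coverAt_eq_coverAt_iff, coverAt_eq_coverAt_iff] at hb
  intro μ
  have hw := blockMap_window (N' := P.sitesPerDir (j + 1)) hL z x μ (by rw [← hNL]; exact hx μ)
  have hL' : (0 : ℤ) < P.L := by exact_mod_cast hL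
  -- `⌊x_μ∕L⌋ ∈ {z_μ, z_μ + [μ = κ]}`
  have hN2 : (2 : ℤ) ≤ (P.sitesPerDir (j + 1) : ℕ) := by exact_mod_cast hN'2
  have hq : blockMap P.L x μ = z μ ∨ blockMap P.L x μ = z μ + (if μ = κ then 1 else 0) := by
    rcases hb with h | h
    · have h0 := B5QGGQ145Torus.int_eq_zero_of_dvd_of_lt (h μ) (by linarith [hw.2]) (by linarith [hw.1])
      left; linarith
    · have heκ : (z + e κ) μ = z μ + (if μ = κ then 1 else 0) := by simp only [Pi.add_apply, e_apply]
      have h' := h μ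
      rw [heκ] at h'
      have hι : (0 : ℤ) ≤ (if μ = κ then 1 else 0) ∧ (if μ = κ then (1 : ℤ) else 0) ≤ 1 := by split_ifs <;> constructor <;> norm_num
      have h0 := B5QGGQ145Torus.int_eq_zero_of_dvd_of_lt h' (by linarith [hw.2, hι.1]) (by linarith [hw.1, hι.2])
      right; linarith
  have h1 := Int.ediv_mul_le (x μ) (ne_of_gt hL')
  have h2 := Int.lt_ediv_add_one_mul_self (x μ) hL'
  simp only [blockMap] at hq
  simp only [bondHi, Pi.smul_apply, smul_eq_mul]
  have hLi : (1 : ℤ) ≤ P.L := by exact_mod_cast hL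
  rcases hq with h | h
  · rw [h] at h1 h2
    constructor
    · linarith
    · split_ifs <;> nlinarith
  · rw [h] at h1 h2
    by_cases hμ : μ = κ
    · rw [if_pos hμ] at h1 h2; rw [if_pos hμ]; constructor <;> nlinarith
    · rw [if_neg hμ] at h1 h2; rw [if_neg hμ]; constructor <;> nlinarith

/-- **LIFT OF A TWO-BLOCK BOND INTO THE CORNER BOX.**  For a torus bond `b̂` with both ends in the two blocks of `ĉ = ⟨π_{j+1} z, κ⟩`, the section point `x = sec_{Lz}(b̂₋)` satisfies
`π_j x = b̂₋`, `π_j (x + e_μ) = b̂₊` (`μ = b̂.dir`) and BOTH `x`, `x + e_μ` lie in the corner box `Q`. [cite: Balaban1987RG1, (0.1)-(0.3) pp.251-252] -/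
theorem lift_twoBlock_bond (hj2 : j + 2 ≤ P.m + P.K) (z : Pt P.d) (κ : Fin P.d) (b : PBond P j)
    (hsrc : blockOf b.src = coverAt P (j + 1) z ∨ blockOf b.src = (⟨coverAt P (j + 1) z, κ⟩ : PBond P (j + 1)).tgt)
    (htgt : blockOf b.tgt = coverAt P (j + 1) z ∨ blockOf b.tgt = (⟨coverAt P (j + 1) z, κ⟩ : PBond P (j + 1)).tgt) :
    ∃ x : Pt P.d, coverAt P j x = b.src ∧ coverAt P j (x + e b.dir) = b.tgt ∧
      InBox ((P.L : ℤ) • z) (bondHi P.L ((P.L : ℤ) • z) κ) x ∧ InBox ((P.L : ℤ) • z) (bondHi P.L ((P.L : ℤ) • z) κ) (x + e b.dir) := by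
  have hj : j + 1 ≤ P.m + P.K := by omega
  have hL : 0 < P.L := by have := P.hL.2; omega
  have hNL := P.sitesPerDir_eq_mul_succ hj
  have hN'L : 2 * P.L ≤ P.sitesPerDir (j + 1) := by
    unfold Params.sitesPerDir
    have h1 : 1 ≤ P.m + P.K - (j + 1) := by omega
    have : P.L ≤ P.L ^ (P.m + P.K - (j + 1)) := by
      calc P.L = P.L ^ 1 := (pow_one _).symm
        _ ≤ P.L ^ (P.m + P.K - (j + 1)) := Nat.pow_le_pow_right hL h1
    omega
  have htgt' : (⟨coverAt P (j + 1) z, κ⟩ : PBond P (j + 1)).tgt = coverAt P (j + 1) (z + e κ) := by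
    rw [PBond.tgt, coverAt_add_e]
  rw [htgt'] at hsrc htgt
  set q : Pt P.d := (P.L : ℤ) • z with hq
  set x : Pt P.d := q + fun μ => ((b.src μ - coverAt P j q μ).val : ℤ) with hxdef
  have hxsrc : coverAt P j x = b.src := coverAt_sec q b.src
  have hxwin : ∀ μ, 0 ≤ x μ - q μ ∧ x μ - q μ < (P.sitesPerDir j : ℕ) := sec_window q b.src
  have hxQ : InBox q (bondHi P.L q κ) x := inBox_of_blockOf_coverAt hj2 z x κ hxwin (by rw [hxsrc]; exact hsrc)
  have hxtgt : coverAt P j (x + e b.dir) = b.tgt := by rw [coverAt_add_e, hxsrc]; rfl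
  refine ⟨x, hxsrc, hxtgt, hxQ, inBox_of_blockOf_coverAt hj2 z (x + e b.dir) κ (fun μ => ?_) (by rw [hxtgt]; exact htgt)⟩
  -- the neighbour stays in the window: `x ∈ Q` gives `x_μ − q_μ ≤ 2L − 1 < N_j − 1`
  have hQμ := hxQ μ
  simp only [bondHi, hq, Pi.smul_apply, smul_eq_mul] at hQμ
  simp only [Pi.add_apply, e_apply, Pi.smul_apply, smul_eq_mul]
  have hNj : ((2 * P.L * P.L : ℕ) : ℤ) ≤ (P.sitesPerDir j : ℕ) := by
    rw [hNL]; exact_mod_cast Nat.mul_le_mul_right _ hN'L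
  have hL2 : (2 : ℤ) ≤ P.L := by have := P.hL.2; exact_mod_cast this
  push_cast at hNj
  have hLL : (2 : ℤ) * P.L + 1 ≤ (P.sitesPerDir j : ℕ) := by nlinarith
  split_ifs at hQμ ⊢ <;> constructor <;> linarith [hQμ.1, hQμ.2]


end Geometry

/-- Floor division of a block site: `⌊(Lz + r)∕L⌋ = z` for `r ∈ [0, L)ᵈ`. [folklore] -/
theorem blockMap_smul_add_boxVec {L : ℕ} (hL : 0 < L) (z : Pt P.d) (r : Fin P.d → Fin L) :
    blockMap L ((L : ℤ) • z + boxVec L r) = z := by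
  funext μ
  have hr := (r μ).isLt
  have hL' : (0 : ℤ) < L := by exact_mod_cast hL
  simp only [blockMap, Pi.add_apply, Pi.smul_apply, smul_eq_mul, boxVec]
  rw [show (L : ℤ) * z μ + ((r μ : ℕ) : ℤ) = ((r μ : ℕ) : ℤ) + (L : ℤ) * z μ from add_comm _ _, Int.add_mul_ediv_left _ _ (ne_of_gt hL'),
    Int.ediv_eq_zero_of_lt (by positivity) (by exact_mod_cast hr), zero_add]

/-- **THE VALUES OF THE BLOCK-CONSTANT PAIR GAUGE.**  With `f = 1[ĉ₊ ↦ g]` on `T^{(j+1)}` (`ĉ = ⟨π_{j+1} z, κ⟩`), the `ℤᵈ` gauge `v = f ∘ blockOf ∘ π_j` equals `1` on the block `B(Lz)` and `g`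
on the block `B(L(z + e_κ))`, and `f(ĉ₋) = 1`, `f(ĉ₊) = g` (the two coarse sites differ since `N_{j+1} ≥ 2`). [cite: Balaban1987RG1, (0.1)-(0.3) pp.251-252] -/
theorem pairGauge_values (hj2 : j + 2 ≤ P.m + P.K) {G : Type*} (one g : G) (z : Pt P.d) (κ : Fin P.d) :
    (∀ r : Fin P.d → Fin P.L, Function.update (fun _ : Site P (j + 1) => one) ((⟨coverAt P (j + 1) z, κ⟩ : PBond P (j + 1)).tgt) g
        (blockOf (coverAt P j ((P.L : ℤ) • z + boxVec P.L r))) = one) ∧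
    (∀ r : Fin P.d → Fin P.L, Function.update (fun _ : Site P (j + 1) => one) ((⟨coverAt P (j + 1) z, κ⟩ : PBond P (j + 1)).tgt) g
        (blockOf (coverAt P j ((P.L : ℤ) • (z + e κ) + boxVec P.L r))) = g) ∧
    Function.update (fun _ : Site P (j + 1) => one) ((⟨coverAt P (j + 1) z, κ⟩ : PBond P (j + 1)).tgt) g (coverAt P (j + 1) z) = one ∧
    Function.update (fun _ : Site P (j + 1) => one) ((⟨coverAt P (j + 1) z, κ⟩ : PBond P (j + 1)).tgt) g ((⟨coverAt P (j + 1) z, κ⟩ : PBond P (j + 1)).tgt) = g := by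
  have hj : j + 1 ≤ P.m + P.K := by omega
  have hL : 0 < P.L := by have := P.hL.2; omega
  have htgt : ((⟨coverAt P (j + 1) z, κ⟩ : PBond P (j + 1)).tgt) = coverAt P (j + 1) (z + e κ) := by rw [PBond.tgt, coverAt_add_e]
  have hne : coverAt P (j + 1) z ≠ coverAt P (j + 1) (z + e κ) := by
    intro h
    rw [coverAt_eq_coverAt_iff] at h
    have h1 := h κ
    simp only [Pi.add_apply, e_apply, if_true, add_sub_cancel_left] at h1
    have hN2 : 2 ≤ P.sitesPerDir (j + 1) := by
      unfold Params.sitesPerDir; have : 1 ≤ P.L ^ (P.m + P.K - (j + 1)) := Nat.one_le_pow _ _ hL; omega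
    have := Int.le_of_dvd one_pos h1
    have : ((P.sitesPerDir (j + 1) : ℕ) : ℤ) ≤ 1 := this
    omega
  refine ⟨fun r => ?_, fun r => ?_, ?_, ?_⟩
  · rw [blockOf_coverAt hj, blockMap_smul_add_boxVec hL, htgt, Function.update_of_ne hne]
  · rw [blockOf_coverAt hj, blockMap_smul_add_boxVec hL, htgt, Function.update_self]
  · rw [htgt, Function.update_of_ne hne]
  · rw [Function.update_self]

/-! ## §2 The sectioned field `S = (v•C) ∘ sec` against the gauged torus field `W = ṽ•D` on a lifted bond -/

section Fields

variable {𝔸 : Type*} [NormedRing 𝔸] [NormOneClass 𝔸]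

/-- **`W⁻¹S` IS A UNITARY CONJUGATE OF `D⁻¹C` ON A LIFTED BOND.**  With `v = f ∘ blockOf ∘ π_j` on `ℤᵈ` and `ṽ = f ∘ blockOf` on the torus, at a torus bond `b̂ = (π_j x, μ)` with
`π_j (x + e_μ) = b̂₊`: `(ṽ•D)(b̂)⁻¹ · (v•C)(x, μ) = v(x+e_μ) · (D(b̂)⁻¹ C(x,μ)) · v(x+e_μ)⁻¹`, hence `‖(ṽ•D)(b̂)⁻¹·(v•C)(x,μ) − 1‖ ≤ ‖D(b̂)⁻¹C(x,μ) − 1‖` for `U1`-valued `f`.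
[cite: Balaban1985Averaging, (8) p.19, (11) p.19] -/
theorem norm_inv_gaugeActT_mul_gaugeAct_sub_one_le (f : Site P (j + 1) → 𝔸ˣ) (hf : ∀ y, f y ∈ U1 𝔸) (C : Pt P.d → Fin P.d → 𝔸ˣ) (D : GaugeField P j 𝔸ˣ)
    (x : Pt P.d) (b : PBond P j) (hsrc : coverAt P j x = b.src) (htgt : coverAt P j (x + e b.dir) = b.tgt) :
    ‖(((gaugeActT (fun y : Site P j => f (blockOf y)) D b)⁻¹ * gaugeAct (fun w => f (blockOf (coverAt P j w))) C x b.dir : 𝔸ˣ) : 𝔸) - 1‖ ≤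
      ‖(((D b)⁻¹ * C x b.dir : 𝔸ˣ) : 𝔸) - 1‖ := by
  have e1 : (gaugeActT (fun y : Site P j => f (blockOf y)) D b)⁻¹ * gaugeAct (fun w => f (blockOf (coverAt P j w))) C x b.dir =
      f (blockOf (coverAt P j (x + e b.dir))) * ((D b)⁻¹ * C x b.dir) * (f (blockOf (coverAt P j (x + e b.dir))))⁻¹ := by
    rw [gaugeActT_apply, ← hsrc, ← htgt]
    simp only [gaugeAct, mul_inv_rev, inv_inv]
    group
  rw [e1]
  exact norm_units_conj_sub_one_le (hf _) _

/-- From the multiplicative closeness to the additive one and to the smallness of the gauged torus field: if `‖W⁻¹S − 1‖ ≤ ρ` and `‖S − 1‖ ≤ δ` with `δ, ρ ≤ 1∕200`, then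
`‖S − W‖ ≤ (102∕100)·ρ` and `‖W − 1‖ ≤ δ + (102∕100)·ρ`. [folklore] -/
theorem norm_sub_le_of_inv_mul {W S : 𝔸ˣ} {δ ρ : ℝ} (hWS : ‖((W⁻¹ * S : 𝔸ˣ) : 𝔸) - 1‖ ≤ ρ) (hS : ‖(S : 𝔸) - 1‖ ≤ δ) (hδ : δ ≤ 1 / 200) (hρ : ρ ≤ 1 / 200) :
    ‖(S : 𝔸) - W‖ ≤ 102 / 100 * ρ ∧ ‖(W : 𝔸) - 1‖ ≤ δ + 102 / 100 * ρ := by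
  have hρ0 : 0 ≤ ρ := (norm_nonneg _).trans hWS
  -- `S − W = W·(W⁻¹S − 1)`
  have e : (S : 𝔸) - W = (W : 𝔸) * (((W⁻¹ * S : 𝔸ˣ) : 𝔸) - 1) := by
    rw [mul_sub, mul_one, Units.val_mul, ← mul_assoc, Units.mul_inv, one_mul]
  have hSn : ‖(S : 𝔸)‖ ≤ 1 + δ := by
    have := norm_le_norm_add_norm_sub' (S : 𝔸) 1; rw [norm_one] at this; linarith
  have h1 : ‖(S : 𝔸) - W‖ ≤ ‖(W : 𝔸)‖ * ρ := by rw [e]; exact (norm_mul_le _ _).trans (by gcongr)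
  -- `‖W‖ ≤ ‖S‖ + ‖S − W‖ ≤ 1 + δ + ‖W‖ρ`, so `‖W‖ ≤ 102∕100`
  have hW1 : ‖(W : 𝔸)‖ ≤ 1 + δ + ‖(W : 𝔸)‖ * ρ := by
    have h2 : ‖(W : 𝔸)‖ ≤ ‖(S : 𝔸)‖ + ‖(S : 𝔸) - W‖ := by
      have := norm_sub_norm_le (W : 𝔸) S; rw [norm_sub_rev] at this; linarith
    linarith
  have hWn : ‖(W : 𝔸)‖ ≤ 102 / 100 := by nlinarith [norm_nonneg (W : 𝔸)]
  have hSW : ‖(S : 𝔸) - W‖ ≤ 102 / 100 * ρ := h1.trans (by gcongr)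
  refine ⟨hSW, ?_⟩
  have e2 : (W : 𝔸) - 1 = ((S : 𝔸) - 1) - ((S : 𝔸) - W) := by abel
  rw [e2]
  exact (norm_sub_le _ _).trans (by linarith)

end Fields

end Summit.QuantumFields.YangMills.Theorems.HalvingCombStepGeometry

end
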